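import Summits.BirchSwinnertonDyer.Rank1Residual.Additive.UnramifiedKummerDoor
import Summits.BirchSwinnertonDyer.Rank1Residual.Additive.AdditiveTamagawaWitnessLayer
import HarnessLib

/-!
# The exact door of `A₀` at an additive place `v ∤ p`: on `p`-torsion classes the `K_∞`-level
# local condition IS `H¹_ur(K_v, E[p]) ⊕ 𝓚_v`; it is `𝓚_v` alone when `E(K_v)[p] = 0`
# (cell `b2b-bsdres`, team n1011, seat p06 GEN 5; OWNERS row T-E3g-DOOR, FILE C)

HONEST FRAMING (cell `b2b-bsdres`, run/shared/lean/b2b/bsd-rank1-residual/, verbatim in every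
file): the goal of the cell is to DELETE the COMBINATION-SHAPED residual classes of the
Birch–Swinnerton-Dyer formula for ALL analytic-rank `≤ 1` elliptic curves over `ℚ` — "full BSD
formula for every rank `≤ 1` curve in class `C`" assembled STRICTLY from published theorems — so
that the rank-`≤ 1` remainder becomes exactly the CONSTRUCTION-SHAPED classes, which are TYPED
(missing-input `Prop`s), NOT attempted. This is not "finishing BSD". Team n1011 (N10/N11: X4 ∧
`p = 3`): research routes on CONSTRUCTION-SHAPED classes; census output = EVIDENCE / conjecture
items, never a Literature fact; RESIDUAL-MAP marks UNCHANGED; nothing is booked by this file.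
THEOREMS ONLY: no definition, no named fact, nothing asserted; a SIZING statement (which local
classes CAN enter the Route-G budget `A₀[p]`), not a yield claim.

## What (row T-E3g-DOOR = r2 ROUTE-2 II.18.4 / ST-18.2 STEP 1 in p10's `A₀` currency; ST-19.4)

For an elliptic curve `E = W` over a number field `K`, a prime `p`, a `ℤ_p`-extension `κ`
(`A₀ = W.selmerInftyPreimage κ 0`, its local condition at `v` being `W.localKerOver p κ.kerSubgroup K_v`
after `h₀ ∘ Ψ`, T-E3g-BUD0 FILES 2/3b), a class `y ∈ H¹(K, E[p])` and a finite place `v ∤ p`: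

* `localResOver_layerToInfty_torsionToPrimaryH1_eq` — bookkeeping (p10's `e1 ∘ e2 ∘ e3`, exported):
  the local restriction of `h₀(Ψ y)` over `K_∞` at `v` is the `H¹(E(K̄_v))`-image of `res_v y`
  restricted to `Gal(K̄_v/K_{∞,η})`;
* §1 `mem_unramified_sup_kummer_of_layerToInfty_mem_localKerOver` (→, NO `hdec`) and
  `layerToInfty_mem_localKerOver_iff_mem_unramified_sup_kummer` (↔, `hdec` for ← only = p10's
  p264947): under `hI` (every `I_v`-fixed point of `E[p^∞]` killed by `p`), **`h₀(Ψ y)` satisfies the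
  local condition of `Sel_{p^∞}(E/K_∞)` at `v` iff `res_v y ∈ H¹_ur(K_v, E[p]) ⊔ 𝓚_v`**;
* §2 the binder-free forms at an ADDITIVE `v ∤ p`, `p` odd (row T-E3g-ADD:
  `inertia_torsion_of_hasAdditiveReductionAt`), where the sum is DIRECT
  (`unramifiedSubgroup_inf_kummerLocalConditionAt_eq_bot_of_hasAdditiveReductionAt`) of index
  `#E(K_v)[p] ∈ {1, p}` over `𝓚_v` (`relIndex_…_of_hasAdditiveReductionAt`);
* §3 DOOR SHUT: if moreover `E[p](K̄)^{Γ_{K_v}} = 0` (no `K_v`-rational `p`-torsion — the explicit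
  hypothesis `hE`; at an additive `v ∤ p` this is `p ∤ c_v`, not consumed here), then
  `H¹_ur(K_v, E[p]) = ⊥` (`unramifiedSubgroup_eq_bot_of_forall_fixed_eq_zero`, from row T-E3g-ADD's
  `#H¹_ur = #E[p]^{Γ}`) and **the local condition of `A₀` at `v` on `p`-torsion classes IS the Kummer
  condition**: such a place contributes NOTHING to the budget;
* §4 the layer-`n` twin over `W.baseChange (κ.layer n)` (`[NumberField (κ.layer n)]` a binder,
  T-res rule), for ANY `ℤ_p`-extension `κ'` of the layer: additivity persists up the layer
  (`hasAdditiveReductionAt_baseChange_of_ramificationIdxIn_eq_one` + `ZpTower.ramificationIdxIn_layer_eq_one`).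

So at every level the additive places contribute to `A_n[p]` EXACTLY their Tamagawa witnesses
(row T-E3g-ADD) and nothing else — r2's `b₀ = t₀ + s₀` / `B(E,p)` has no hidden additive term.
NOT claimed: the GLOBAL half of the joint door (pair-count exactness: p10's T-E3g-JOINT), the door
at `p` itself (r2 ST-19.1), multiplicative places (`hI` fails).

References: R. Greenberg, LNM 1716 (1999) §2 Prop. 2.1, p. 74, §3 Lemma 3.3, §5 pp. 114–118
[GreenbergLNM1716]; J. S. Milne, *ADT* (2006) I §2, I Lemma 2.9, I Prop. 3.8 [MilneADT2006];
J. H. Silverman, *AEC* (2009) Thm. VII.6.1 [SilvermanAEC2009]; L. Washington, *Cyclotomic Fields*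
Prop. 13.2 [Washington1997].
-/

set_option autoImplicit false

noncomputable section

open scoped Classical ContRepresentation

open CategoryTheory Field ValuativeRel NumberField IsDedekindDomain Function
open Literature.NumberTheory.EllipticCurves Literature.NumberTheory.GaloisRepresentations
  Literature.NumberTheory.GaloisRepresentations.IsNonarchimedeanLocalField
open Summit.BirchSwinnertonDyer.Rank1Residual.X11b
open WeierstrassCurve

namespace Summit.BirchSwinnertonDyer.Rank1Residual.Additive

universe u

/-! ### §0 Generic: `H¹_ur(F, A) = ⊥` when `A^{Γ_F} = 0` -/

section Generic

variable {F : Type u} [Field F] [ValuativeRel F] [TopologicalSpace F] [IsNonarchimedeanLocalField F]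
  {A : Type u} [AddCommGroup A] [TopologicalSpace A] [DiscreteTopology A] [Finite A]
  (ρ : DiscreteGaloisModule F A)

/-- **`H¹_ur(F, A) = ⊥` for a finite discrete module `A` with `A^{Γ_F} = 0`**: `#H¹_ur(F, A) = #A^{Γ_F}`
(row T-E3g-ADD FILE A, `natCard_unramifiedSubgroup_eq_natCard_invariants_general`; Milne *ADT*
I Lemma 2.9). [cite: MilneADT2006, Ch. I, Lemma 2.9] -/
theorem unramifiedSubgroup_eq_bot_of_forall_fixed_eq_zero
    (h0 : ∀ a : A, (∀ σ : absoluteGaloisGroup F, ρ σ a = a) → a = 0) :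
    DiscreteGaloisModule.unramifiedSubgroup ρ 1 = ⊥ := by
  apply AddSubgroup.eq_bot_of_card_eq
  rw [natCard_unramifiedSubgroup_eq_natCard_invariants_general ρ]
  haveI : Subsingleton ρ.toTopRep.ρ.invariants := ⟨fun x y ↦ Subtype.ext (by
    rw [h0 x.1 ((Representation.mem_invariants _ _).mp x.2),
      h0 y.1 ((Representation.mem_invariants _ _).mp y.2)])⟩
  exact Nat.card_of_subsingleton (0 : ρ.toTopRep.ρ.invariants)

end Generic

/-! ### §1 The door of `A₀` at `v ∤ p` in p10's currency -/

section Curve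

variable {K : Type u} [Field K] [NumberField K] (W : WeierstrassCurve K) [W.IsElliptic] (p : ℕ)
  [hp : Fact p.Prime] (κ : ZpExtension K p) (v : HeightOneSpectrum (𝓞 K))

omit [W.IsElliptic] in
/-- **Bookkeeping: the local restriction of `h₀(Ψ y)` over `K_∞` at `v`** is the image of `res_v y`
in `H¹(Γ_{K_v}, E(K̄_v))` restricted to `Gal(K̄_v/K_{∞,η})` (restriction commutes with the local
restrictions; the three identities `e1`, `e2`, `e3` of p10's T-E3g-BUD0 FILE 3b, exported).
[cite: GreenbergLNM1716, §2–§3 (pp. 85–86)] -/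
theorem localResOver_layerToInfty_torsionToPrimaryH1_eq (y : galH1Torsion W (p : ℤ)) :
    W.localResOver p κ.kerSubgroup (v.adicCompletion K)
        (W.layerToInfty κ 0 (resH1Hom (Literature.NumberTheory.EllipticCurves.subgroupIncl (κ.layerSubgroup 0))
          (AddMonoidHom.id (geomPrimaryTorsion W p)) (fun _ _ ↦ rfl) (torsionToPrimaryH1 W p y))) =
      resH1Hom (Literature.NumberTheory.EllipticCurves.subgroupIncl
          (localSubgroup κ.kerSubgroup (v.adicCompletion K)))
        (AddMonoidHom.id (localPoints W (v.adicCompletion K))) (fun _ _ ↦ rfl)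
        (galoisCohomology.map (W.torsionPointsMapIntertwining (p : ℤ) (v.adicCompletion K)) 1
          (galoisCohomology.res (W.torsionGaloisModule (p : ℤ)) (v.adicCompletion K) 1 y)) := by
  -- `h_0 ∘ res_{K_0} = res_{K_∞}` on `H¹(K, E[p^∞])`
  have e1 : ∀ c : W.galH1Primary p,
      W.layerToInfty κ 0 (resH1Hom (Literature.NumberTheory.EllipticCurves.subgroupIncl (κ.layerSubgroup 0))
        (AddMonoidHom.id (geomPrimaryTorsion W p)) (fun _ _ ↦ rfl) c) =
      resH1Hom (Literature.NumberTheory.EllipticCurves.subgroupIncl κ.kerSubgroup)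
        (AddMonoidHom.id (geomPrimaryTorsion W p)) (fun _ _ ↦ rfl) c := fun c ↦ by
    change resH1Hom (subgroupInclusion (κ.kerSubgroup_le_layerSubgroup 0))
      (AddMonoidHom.id (geomPrimaryTorsion W p)) (fun _ _ ↦ rfl) (resH1Hom _ _ _ c) = _
    rw [resH1Hom_resH1Hom]
    exact DFunLike.congr_fun (resH1Hom_congr (by ext; rfl) (by ext; rfl) _ _) c
  -- the local restriction over `K_∞` after `res_{K_∞}`
  have e2 : ∀ c : W.galH1Primary p,
      W.localResOver p κ.kerSubgroup (v.adicCompletion K)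
        (resH1Hom (Literature.NumberTheory.EllipticCurves.subgroupIncl κ.kerSubgroup)
          (AddMonoidHom.id (geomPrimaryTorsion W p)) (fun _ _ ↦ rfl) c) =
      resH1Hom (Literature.NumberTheory.EllipticCurves.subgroupIncl
          (localSubgroup κ.kerSubgroup (v.adicCompletion K)))
        (AddMonoidHom.id (localPoints W (v.adicCompletion K))) (fun _ _ ↦ rfl)
        (resH1Hom (resGal (K := K) (v.adicCompletion K))
          ((pointsMap W (v.adicCompletion K)).comp (geomPrimaryTorsion W p).subtype)
          (W.pointsMap_comp_subtype_smul p) c) := fun c ↦ by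
    show resH1Hom (resGalSubgroupOfEmb κ.kerSubgroup (closureEmb (K := K) (v.adicCompletion K)))
        ((pointsMapOfEmb W (closureEmb (K := K) (v.adicCompletion K))).comp
          (geomPrimaryTorsion W p).subtype)
        (W.pointsMapOfEmb_comp_subtype_smul p (closureEmb (K := K) (v.adicCompletion K)) κ.kerSubgroup)
        (resH1Hom (Literature.NumberTheory.EllipticCurves.subgroupIncl κ.kerSubgroup)
          (AddMonoidHom.id (geomPrimaryTorsion W p)) (fun _ _ ↦ rfl) c) = _
    rw [resH1Hom_resH1Hom, resH1Hom_resH1Hom]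
    exact DFunLike.congr_fun (resH1Hom_congr (by ext; rfl) (by ext; rfl) _ _) c
  -- `(E[p] ↪ E[p^∞])_*` then the pair `(resGal, pointsMap ∘ incl)` = `map ∘ res`
  have e3 : resH1Hom (resGal (K := K) (v.adicCompletion K))
        ((pointsMap W (v.adicCompletion K)).comp (geomPrimaryTorsion W p).subtype)
        (W.pointsMap_comp_subtype_smul p) (torsionToPrimaryH1 W p y) =
      galoisCohomology.map (W.torsionPointsMapIntertwining (p : ℤ) (v.adicCompletion K)) 1
        (galoisCohomology.res (W.torsionGaloisModule (p : ℤ)) (v.adicCompletion K) 1 y) := by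
    rw [map_res_torsionGaloisModule_apply, torsionToPrimaryH1, resH1Hom_resH1Hom]
    exact DFunLike.congr_fun (resH1Hom_congr (by ext; rfl) (by ext; rfl) _ _) y
  rw [e1, e2, e3]

/-- **THE DOOR CONVERSE for `A₀` at `v ∤ p` (NO `hdec`).** If every `I_v`-fixed point of `E[p^∞]` is
killed by `p` (`hI`) and `h₀(Ψ y)` satisfies the local condition of `Sel_{p^∞}(E/K_∞)` at `v`, then
`res_v y ∈ H¹_ur(K_v, E[p]) ⊔ 𝓚_v`. [cite: GreenbergLNM1716, §2 Prop. 2.1 (p. 72), p. 74]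
[cite: MilneADT2006, Ch. I §2 and Prop. 3.8] -/
theorem mem_unramified_sup_kummer_of_layerToInfty_mem_localKerOver
    (hpv : ((p : ℕ) : 𝓞 K) ∉ v.asIdeal)
    (hI : ∀ Q : W.geomPrimaryTorsion p,
      (∀ τ ∈ absInertia (v.adicCompletion K),
        GaloisRep.restrictField (v.adicCompletion K) (LocBridge.primaryGaloisModule W p) τ Q = Q) →
      p • Q = 0)
    (y : galH1Torsion W (p : ℤ))
    (hy : W.layerToInfty κ 0 (resH1Hom (Literature.NumberTheory.EllipticCurves.subgroupIncl (κ.layerSubgroup 0))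
        (AddMonoidHom.id (geomPrimaryTorsion W p)) (fun _ _ ↦ rfl) (torsionToPrimaryH1 W p y)) ∈
      W.localKerOver p κ.kerSubgroup (v.adicCompletion K)) :
    galoisCohomology.res (W.torsionGaloisModule (p : ℤ)) (v.adicCompletion K) 1 y ∈
      DiscreteGaloisModule.unramifiedSubgroup
        ((W.torsionGaloisModule (p : ℤ)).restrictField (v.adicCompletion K)) 1 ⊔
      W.kummerLocalConditionAt (p : ℤ) (v.adicCompletion K) := by
  rw [mem_localKerOver_iff, localResOver_layerToInfty_torsionToPrimaryH1_eq] at hy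
  exact mem_unramifiedSubgroup_sup_kummerLocalConditionAt_of_resH1Hom_eq_zero W p v hpv hI
    (localSubgroup κ.kerSubgroup (v.adicCompletion K))
    (absInertia_le_localSubgroup_kerSubgroup p v κ hpv) hy

/-- **THE DOOR of `A₀` at `v ∤ p` (`iff`).** For `v` not totally split in `K_∞` (`hdec`, used in `←`
only — p10's p264947) and `E[p^∞]^{I_v}` killed by `p` (`hI`, used in `→` only): `h₀(Ψ y)` satisfies
the local condition of `Sel_{p^∞}(E/K_∞)` at `v` IFF `res_v y ∈ H¹_ur(K_v, E[p]) ⊔ 𝓚_v`.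
[cite: GreenbergLNM1716, §2 p. 74 and §3 Lemma 3.3 (pp. 86–87)] [cite: MilneADT2006, Ch. I Prop. 3.8] -/
theorem layerToInfty_mem_localKerOver_iff_mem_unramified_sup_kummer
    (hpv : ((p : ℕ) : 𝓞 K) ∉ v.asIdeal)
    (hdec : ∃ σ : absoluteGaloisGroup (v.adicCompletion K),
      κ (resGal (K := K) (v.adicCompletion K) σ) ≠ 1)
    (hI : ∀ Q : W.geomPrimaryTorsion p,
      (∀ τ ∈ absInertia (v.adicCompletion K),
        GaloisRep.restrictField (v.adicCompletion K) (LocBridge.primaryGaloisModule W p) τ Q = Q) →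
      p • Q = 0)
    (y : galH1Torsion W (p : ℤ)) :
    W.layerToInfty κ 0 (resH1Hom (Literature.NumberTheory.EllipticCurves.subgroupIncl (κ.layerSubgroup 0))
        (AddMonoidHom.id (geomPrimaryTorsion W p)) (fun _ _ ↦ rfl) (torsionToPrimaryH1 W p y)) ∈
      W.localKerOver p κ.kerSubgroup (v.adicCompletion K) ↔
    galoisCohomology.res (W.torsionGaloisModule (p : ℤ)) (v.adicCompletion K) 1 y ∈
      DiscreteGaloisModule.unramifiedSubgroup
        ((W.torsionGaloisModule (p : ℤ)).restrictField (v.adicCompletion K)) 1 ⊔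
      W.kummerLocalConditionAt (p : ℤ) (v.adicCompletion K) :=
  ⟨mem_unramified_sup_kummer_of_layerToInfty_mem_localKerOver W p κ v hpv hI y,
    layerToInfty_resH1Hom_torsionToPrimaryH1_mem_localKerOver_of_mem_unramified_sup_kummer W p κ v
      hpv hdec y⟩

/-! ### §2 Additive places `v ∤ p`, `p` odd (binder-free) -/

/-- **The door converse of `A₀` at an ADDITIVE `v ∤ p`, `p` odd (NO `hdec`, NO `hI`).**
[cite: SilvermanAEC2009, Thm. VII.6.1] [cite: GreenbergLNM1716, §2, p. 74] -/
theorem mem_unramified_sup_kummer_of_layerToInfty_mem_localKerOver_of_hasAdditiveReductionAt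
    (hpv : ((p : ℕ) : 𝓞 K) ∉ v.asIdeal) (hp2 : p ≠ 2) (hadd : W.HasAdditiveReductionAt v)
    (y : galH1Torsion W (p : ℤ))
    (hy : W.layerToInfty κ 0 (resH1Hom (Literature.NumberTheory.EllipticCurves.subgroupIncl (κ.layerSubgroup 0))
        (AddMonoidHom.id (geomPrimaryTorsion W p)) (fun _ _ ↦ rfl) (torsionToPrimaryH1 W p y)) ∈
      W.localKerOver p κ.kerSubgroup (v.adicCompletion K)) :
    galoisCohomology.res (W.torsionGaloisModule (p : ℤ)) (v.adicCompletion K) 1 y ∈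
      DiscreteGaloisModule.unramifiedSubgroup
        ((W.torsionGaloisModule (p : ℤ)).restrictField (v.adicCompletion K)) 1 ⊔
      W.kummerLocalConditionAt (p : ℤ) (v.adicCompletion K) :=
  mem_unramified_sup_kummer_of_layerToInfty_mem_localKerOver W p κ v hpv
    (inertia_torsion_of_hasAdditiveReductionAt W p v hpv hp2 hadd) y hy

/-- **THE DOOR of `A₀` at an ADDITIVE `v ∤ p`, `p` odd (`iff`; `hdec` for `←` only)**: on `p`-torsion
classes the local condition of `Sel_{p^∞}(E/K_∞)` at `v` IS `H¹_ur(K_v, E[p]) ⊔ 𝓚_v` — a DIRECT sum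
(`unramifiedSubgroup_inf_kummerLocalConditionAt_eq_bot_of_hasAdditiveReductionAt`) of index
`#E(K_v)[p] ∈ {1, p}` over `𝓚_v` (`relIndex_kummerLocalConditionAt_sup_unramifiedSubgroup_of_hasAdditiveReductionAt`).
[cite: SilvermanAEC2009, Thm. VII.6.1] [cite: GreenbergLNM1716, §2 p. 74 and §3 Lemma 3.3] -/
theorem layerToInfty_mem_localKerOver_iff_mem_unramified_sup_kummer_of_hasAdditiveReductionAt
    (hpv : ((p : ℕ) : 𝓞 K) ∉ v.asIdeal) (hp2 : p ≠ 2) (hadd : W.HasAdditiveReductionAt v)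
    (hdec : ∃ σ : absoluteGaloisGroup (v.adicCompletion K),
      κ (resGal (K := K) (v.adicCompletion K) σ) ≠ 1)
    (y : galH1Torsion W (p : ℤ)) :
    W.layerToInfty κ 0 (resH1Hom (Literature.NumberTheory.EllipticCurves.subgroupIncl (κ.layerSubgroup 0))
        (AddMonoidHom.id (geomPrimaryTorsion W p)) (fun _ _ ↦ rfl) (torsionToPrimaryH1 W p y)) ∈
      W.localKerOver p κ.kerSubgroup (v.adicCompletion K) ↔
    galoisCohomology.res (W.torsionGaloisModule (p : ℤ)) (v.adicCompletion K) 1 y ∈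
      DiscreteGaloisModule.unramifiedSubgroup
        ((W.torsionGaloisModule (p : ℤ)).restrictField (v.adicCompletion K)) 1 ⊔
      W.kummerLocalConditionAt (p : ℤ) (v.adicCompletion K) :=
  layerToInfty_mem_localKerOver_iff_mem_unramified_sup_kummer W p κ v hpv hdec
    (inertia_torsion_of_hasAdditiveReductionAt W p v hpv hp2 hadd) y

/-! ### §3 Door SHUT: no `K_v`-rational `p`-torsion -/

/-- **DOOR SHUT at a place `v ∤ p` with `hI` and `E[p]^{Γ_{K_v}} = 0`** (explicit hypothesis `hE`: no
nonzero `Γ_{K_v}`-fixed point of `E[p](K̄)`, i.e. `E(K_v)[p] = 0`): `H¹_ur(K_v, E[p]) = ⊥`, so on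
`p`-torsion classes the local condition of `Sel_{p^∞}(E/K_∞)` at `v` IS the Kummer condition `𝓚_v`
(`hdec` for `←` only). Such a place contributes nothing to `A₀[p]` beyond the Selmer condition.
[cite: MilneADT2006, Ch. I, Lemma 2.9 and Prop. 3.8] [cite: GreenbergLNM1716, §2, p. 74] -/
theorem layerToInfty_mem_localKerOver_iff_mem_kummer_of_forall_fixed_eq_zero
    (hpv : ((p : ℕ) : 𝓞 K) ∉ v.asIdeal)
    (hdec : ∃ σ : absoluteGaloisGroup (v.adicCompletion K),
      κ (resGal (K := K) (v.adicCompletion K) σ) ≠ 1)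
    (hI : ∀ Q : W.geomPrimaryTorsion p,
      (∀ τ ∈ absInertia (v.adicCompletion K),
        GaloisRep.restrictField (v.adicCompletion K) (LocBridge.primaryGaloisModule W p) τ Q = Q) →
      p • Q = 0)
    (hE : ∀ P : W.geomTorsion (p : ℤ),
      (∀ σ : absoluteGaloisGroup (v.adicCompletion K),
        GaloisRep.restrictField (v.adicCompletion K) (W.torsionGaloisModule (p : ℤ)) σ P = P) → P = 0)
    (y : galH1Torsion W (p : ℤ)) :
    W.layerToInfty κ 0 (resH1Hom (Literature.NumberTheory.EllipticCurves.subgroupIncl (κ.layerSubgroup 0))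
        (AddMonoidHom.id (geomPrimaryTorsion W p)) (fun _ _ ↦ rfl) (torsionToPrimaryH1 W p y)) ∈
      W.localKerOver p κ.kerSubgroup (v.adicCompletion K) ↔
    galoisCohomology.res (W.torsionGaloisModule (p : ℤ)) (v.adicCompletion K) 1 y ∈
      W.kummerLocalConditionAt (p : ℤ) (v.adicCompletion K) := by
  haveI : NeZero p := ⟨hp.out.ne_zero⟩
  haveI : Finite (W.geomTorsion (p : ℤ)) := finite_geomTorsion_of_neZero W p
  rw [layerToInfty_mem_localKerOver_iff_mem_unramified_sup_kummer W p κ v hpv hdec hI y,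
    unramifiedSubgroup_eq_bot_of_forall_fixed_eq_zero _ hE, bot_sup_eq]

/-- **DOOR SHUT at an ADDITIVE place `v ∤ p`, `p` odd, with `E(K_v)[p] = 0`** (explicit `hE`; at an
additive `v ∤ p` this is the non-Tamagawa case `p ∤ c_v`, NOT consumed here — row T-E3g-ADD FILE C
gives the converse `p ∣ c_v ⇒ E(K_v)[p] ≠ 0`): on `p`-torsion classes the local condition of
`Sel_{p^∞}(E/K_∞)` at `v` IS `𝓚_v`. [cite: SilvermanAEC2009, Thm. VII.6.1]
[cite: MilneADT2006, Ch. I, Lemma 2.9 and Prop. 3.8] -/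
theorem layerToInfty_mem_localKerOver_iff_mem_kummer_of_hasAdditiveReductionAt_of_forall_fixed_eq_zero
    (hpv : ((p : ℕ) : 𝓞 K) ∉ v.asIdeal) (hp2 : p ≠ 2) (hadd : W.HasAdditiveReductionAt v)
    (hdec : ∃ σ : absoluteGaloisGroup (v.adicCompletion K),
      κ (resGal (K := K) (v.adicCompletion K) σ) ≠ 1)
    (hE : ∀ P : W.geomTorsion (p : ℤ),
      (∀ σ : absoluteGaloisGroup (v.adicCompletion K),
        GaloisRep.restrictField (v.adicCompletion K) (W.torsionGaloisModule (p : ℤ)) σ P = P) → P = 0)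
    (y : galH1Torsion W (p : ℤ)) :
    W.layerToInfty κ 0 (resH1Hom (Literature.NumberTheory.EllipticCurves.subgroupIncl (κ.layerSubgroup 0))
        (AddMonoidHom.id (geomPrimaryTorsion W p)) (fun _ _ ↦ rfl) (torsionToPrimaryH1 W p y)) ∈
      W.localKerOver p κ.kerSubgroup (v.adicCompletion K) ↔
    galoisCohomology.res (W.torsionGaloisModule (p : ℤ)) (v.adicCompletion K) 1 y ∈
      W.kummerLocalConditionAt (p : ℤ) (v.adicCompletion K) :=
  layerToInfty_mem_localKerOver_iff_mem_kummer_of_forall_fixed_eq_zero W p κ v hpv hdec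
    (inertia_torsion_of_hasAdditiveReductionAt W p v hpv hp2 hadd) hE y

end Curve

/-! ### §4 The layer-`n` twin (every `ℤ_p`-extension `κ'` of `K_n = κ.layer n`) -/

section Layer

variable {K : Type} [Field K] [NumberField K] (W : WeierstrassCurve K) [W.IsElliptic] (p : ℕ)
  [hp : Fact p.Prime] (κ : ZpExtension K p) (n : ℕ) [NumberField (κ.layer n)]
  [(W.baseChange (κ.layer n)).IsElliptic]
  (κ' : ZpExtension (κ.layer n) p) {v : HeightOneSpectrum (𝓞 K)}
  (w : HeightOneSpectrum (𝓞 (κ.layer n)))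

/-- **THE DOOR AT THE LAYER `K_n`, additive `v ∤ p`, `p` odd** (`[NumberField (κ.layer n)]` and
`[(W.baseChange (κ.layer n)).IsElliptic]` binders — both dischargeable, `Additive.numberField_layer`
and `inferInstance` after `dsimp only [WeierstrassCurve.baseChange]`; `κ'` ANY `ℤ_p`-extension of
`K_n`, e.g. the restricted tower of T-E3g-BUDn-K; `w ∣ v`; `hdec` for `κ'` at `w`, used in `←` only):
additive reduction persists at `w` (`v ∤ p` is unramified in `K_n`, `ZpTower.ramificationIdxIn_layer_eq_one`),
so on `p`-torsion classes of `E_{K_n}` the local condition of `Sel_{p^∞}(E/K'_∞)` at `w` IS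
`H¹_ur(K_{n,w}, E[p]) ⊔ 𝓚_w`.
[cite: SilvermanAEC2009, Prop. VII.5.4 and Thm. VII.6.1] [cite: GreenbergLNM1716, §2 p. 74, §5 pp. 114–118] -/
theorem layerToInfty_mem_localKerOver_iff_mem_unramified_sup_kummer_layer_of_hasAdditiveReductionAt
    (hw : w.asIdeal.under (𝓞 K) = v.asIdeal) (hpv : ((p : ℕ) : 𝓞 K) ∉ v.asIdeal) (hp2 : p ≠ 2)
    (hadd : W.HasAdditiveReductionAt v)
    (hdec : ∃ σ : absoluteGaloisGroup (w.adicCompletion (κ.layer n)),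
      κ' (resGal (K := κ.layer n) (w.adicCompletion (κ.layer n)) σ) ≠ 1)
    (y : galH1Torsion (W.baseChange (κ.layer n)) (p : ℤ)) :
    (W.baseChange (κ.layer n)).layerToInfty κ' 0
        (resH1Hom (Literature.NumberTheory.EllipticCurves.subgroupIncl (κ'.layerSubgroup 0))
          (AddMonoidHom.id (geomPrimaryTorsion (W.baseChange (κ.layer n)) p)) (fun _ _ ↦ rfl)
          (torsionToPrimaryH1 (W.baseChange (κ.layer n)) p y)) ∈
      (W.baseChange (κ.layer n)).localKerOver p κ'.kerSubgroup (w.adicCompletion (κ.layer n)) ↔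
    galoisCohomology.res ((W.baseChange (κ.layer n)).torsionGaloisModule (p : ℤ))
        (w.adicCompletion (κ.layer n)) 1 y ∈
      DiscreteGaloisModule.unramifiedSubgroup
        (((W.baseChange (κ.layer n)).torsionGaloisModule (p : ℤ)).restrictField
          (w.adicCompletion (κ.layer n))) 1 ⊔
      (W.baseChange (κ.layer n)).kummerLocalConditionAt (p : ℤ) (w.adicCompletion (κ.layer n)) := by
  have hpw : ((p : ℕ) : 𝓞 (κ.layer n)) ∉ w.asIdeal := fun h ↦ hpv (by
    rw [← hw, Ideal.mem_under, map_natCast]; exact h)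
  have haddw : (W.baseChange (κ.layer n)).HasAdditiveReductionAt w :=
    hasAdditiveReductionAt_baseChange_of_ramificationIdxIn_eq_one W (κ.layer n) hw
      (ZpTower.ramificationIdxIn_layer_eq_one κ n hpv) hadd
  exact layerToInfty_mem_localKerOver_iff_mem_unramified_sup_kummer_of_hasAdditiveReductionAt
    (W.baseChange (κ.layer n)) p κ' w hpw hp2 haddw hdec y

end Layer

end Summit.BirchSwinnertonDyer.Rank1Residual.Additive

end
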